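import Summits.QuantumFields.YangMills.Theses.LangevinControlUV
import Summits.QuantumFields.YangMills.Theorems.LangevinControlUVGapToContinuumCommensurableTransfer
import Summits.QuantumFields.YangMills.Theorems.LangevinControlUVGapToContinuumOneLegSmearedField
import Summits.QuantumFields.YangMills.Theorems.LangevinControlUVGapToContinuumZeroCoupling
import HarnessLib

/-!
# Ladder line `OneLegTame` under crux `GapToContinuum` (stmt-QuantumFields-8896) — `Lines/OneLegTame.lean`

Forward generator G4 `ladder-down` (unit `fwd-ladder-QuantumFields-50`, planner, 2026-08-17).
TOP = the crux `Summit.QuantumFields.YangMills.Theses.LangevinControlUV.GapToContinuum`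
(`∀ G r sch T Δ, 0 < Δ → IsYangMillsFor r sch T → HasLatticeMassGap r sch Δ → T.HasMassGap Δ`;
BLOCKED bin, census `Cruxes/GapToContinuum/STRATEGY-CENSUS.md` r1: misstated as typed — defects
D1 `0 ≤ β_k` untyped, D2 per-pair thresholds vs the `k`-growing product family, D3b own-torus
currency needs growth clauses).  This file does NOT prove the crux and files no stub equivalent to it.

## The rung (`OneLegTame`, `rung_decl`)

The crux's body VERBATIM (same per-pair antecedent `HasLatticeMassGap r sch Δ`, same `IsYangMillsFor`,
same rate `Δ`) with (i) the conclusion restricted to the `(1,1)` sector of `T.HasMassGap Δ`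
(`OneLegSector T Δ`: one smeared leg on each side, every species pair, every time-ordered Schwartz
test function) and (ii) the scheme restricted to the TAME class of the landed R7 transfer
(`IsTameScheme`: spacings eventually commensurable with one physical length, `0 ≤ β_k` eventually,
`a_k L_k / log a_k⁻¹ → ∞`, reflection-symmetric polynomially bounded renormalisations — the exact
hypothesis list of `Theorems/…CommensurableTransfer.lean :: gapToContinuum_commensurableTransfer`,
p127790).  Gradation parameters moved: ARITY (all sectors ↦ sector `(1,1)`) and SCHEME CLASS
(all `sch` ↦ tame `sch`); the INPUT stays the crux's own per-pair clustering — that is the one real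
step beyond the floors:

* floor A (R7, p127790, `…SlabTransfer.gapToContinuum_commensurableTransfer`): tame schemes, ALL
  sectors, but from PAIR-UNIFORM slab clustering in cluster-expansion format (one constant / one
  threshold for every slab observable, polynomial prefactor) — not from `HasLatticeMassGap`;
* floor B (p141172, `…ZeroCoupling.gapToContinuum_on_zeroCouplingStratum`): the crux on the stratum
  `∀ᶠ k, β_k = 0` (ultralocal), all sectors, `HasLatticeMassGap` idle;
* floor C (c10, p150813 + p152087, `…OneLeg.stub_oneLegSmearedFarBound`): the LATTICE half of this
  rung — from ONE instance of `HasLatticeMassGap` (pair `(Θs, s)`), at `0 ≤ β_k`, the whole-range far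
  bound for the smeared renormalised one-leg field on the scheme's own odd torus, constant
  `(|c_s(k)| a_k⁴ Σ|p|)² C_s` (defect D2 absent in the one-leg sector: RP Cauchy–Schwarz collapses the
  translated cross pairs onto the certified pair).
Section *Witness* below (mirrored in `Lines/OneLegTame_special.lean`) proves the rung's specialisations to floors A and B (no `sorry`).

## Stubs (3) and composition

* `stub_crossFarBound` (lattice, per-pair; extends floor C to TWO base observables): for an arity-1
  slab sum `D` and species `σ`, the four polarisation combinations `X_k + c•Y_k` (`‖c‖ ≤ 1`) of the
  reflected-species representative `X_k = D.rep sch (Θσ) k` and `Y_k = D.rep sch σ k` obey, eventually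
  in `k` and at `0 ≤ β_k`, the far bound `(|c_σ(k)|+1)² C e^{−Δ a_k N}` on the physical window
  `2 a_k N + κ₀ ≤ a_k L_k` — from the TWO certified pairs `(σ, Θσ)`, `(Θσ, σ)` of `HasLatticeMassGap`
  (polarised RP Cauchy–Schwarz `norm_osCorr_iterate_sq_le` on each cross pair of translates; spatial
  translation invariance; `m_s(k)` invisible; `c_{Θσ} = c_σ` by reflection symmetry).
* `stub_hankelTransferOne` (lattice → continuum, arity 1; R7's `hasMassGap_of_slabClustering_commensurable`
  re-run at `nn = 1` with the far bound supplied ONLY for the four combinations): tame scheme +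
  `IsYangMillsFor` + the conclusion of `stub_crossFarBound` ⟹ the arity-1 diagonal bound on `T` along the
  progression `j t₀` with constant `2(v_F + v_G)` (Hankel chain `HankelSite.norm_osCorr_negReflect_le_of_decay_lt`
  per combination, polarisation identity, `tendsto_osVar_rep` / `tendsto_osCorr_rep`, loss factor
  `((|c_σ(k)|+1)² C / osVar)^{2^{-J_k}} → 1` because `log |c_σ(k)| = O(log a_k⁻¹) = o(a_k L_k)`).
* `stub_oneLegSector_of_diagBoundOne` (OS reconstruction at fixed arity): arity-1 diagonal progression
  bounds ⟹ `OneLegSector T Δ` — the Literature proof of `OSData.hasMassGap_of_diagBound_progression`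
  (`MassGapFromProgressionClustering`, `MassGapFromDiagonalClustering`, `MassGapFromSpanClustering`:
  self-improvement along the progression, Cauchy–Schwarz on span × span, density) is per `(n, m)`; run it
  at `(1,1)`.
* `OneLegTame_of : OneLegTame` — the composition, stubs BY NAME; the `example` after it is the same glue
  with the three stub statements as explicit hypotheses (a real proof, no `sorry`).

## Ladder (named distance, NOT stubs): `OneLegTame → TameGapToContinuum → GapToContinuum`

the `example` after `oneLegTame_of_tameGapToContinuum` types the two gaps above the rung: `OneLegTame → TameGapToContinuum` is the
multi-leg step on tame schemes (defect D2: the arity-`n ≥ 2` lattice representative is a `k`-growing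
family of translated PRODUCT pairs; `Negative/HeavyProductLeak.lean`, p120725, is the abstract reason
one-leg data does not generate it), and `TameGapToContinuum → GapToContinuum` is the removal of
tameness (defects D1/D3b = the census's misstatement; its door is the re-type R5, not a proof).  Both
fail `→ YangMills` and `→ GapToContinuum` cheaply (registrar folder `bc/OneLegTame_probe.lean`).
On-path certificate: `oneLegTame_of_gapToContinuum : GapToContinuum → OneLegTame` (proved here).

## Disproof used

`Negative/WithoutIsYangMillsFor.lean` (p120966): any proof must use `IsYangMillsFor` — used in
`stub_hankelTransferOne` (limits of representatives).  `Negative/HeavyProductLeak.lean` (p120725): not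
touched — the line never derives multi-leg data from one-leg data (that is the named gap, not a stub).
`Disproof.lean` §3 (`HasLatticeMassGap` load-bearing): consumed by `stub_crossFarBound` (two pairs).
Sibling `LatticeGapOnTrajectory/Negative/Residuals.lean` (p132883, `volumeGrowth_false_without_tuning`):
the volume-growth clause is carried explicitly in `IsTameScheme`, never derived.

References: Osterwalder–Seiler 1978 §2; Glimm–Jaffe 1987 §6.1 (Thm 6.1.3), §19.7;
Fröhlich–Israel–Lieb–Simon 1978 §2; Osterwalder–Schrader 1973 §4.1.
-/

open scoped SchwartzMap Topology ComplexConjugate ComplexOrder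
open Filter Set MeasureTheory
open Literature.MathematicalPhysics.AQFT Literature.MathematicalPhysics.QuantumLattice
open Literature.MathematicalPhysics.QuantumFieldTheory
open Summit.QuantumFields.YangMills.Cruxes.LatticeGapOnTrajectory.OrbitKantorovichFiniteSize
open Summit.QuantumFields.YangMills.Cruxes.LatticeGapOnTrajectory.OrbitKantorovichFiniteSize.Transfer

noncomputable section

namespace Summit.QuantumFields.YangMills.Cruxes.GapToContinuum.OneLegTameLine

/-! ## The rung and the ladder -/

/-- **The `(1,1)` sector of `T.HasMassGap Δ`**: one leg on each side, every species pair, every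
time-ordered Schwartz test function, free constant (verbatim `OSData.HasMassGap` at `n = m = 1`;
same text as the census's `OneLegGap`, `Cruxes/GapToContinuum/StrategyCensus.lean`). -/
def OneLegSector {ι : Type} (T : OSData ι 4) (Δ : ℝ) : Prop :=
  ∀ (k k' : Fin 1 → ι) (F G : 𝓢((Fin 1 → EuclideanSpace ℝ (Fin 4)), ℂ)),
    IsTimeOrdered F → IsTimeOrdered G →
      ∃ C : ℝ, ∀ t : ℝ, 0 ≤ t →
        ∀ H : 𝓢((Fin (1 + 1) → EuclideanSpace ℝ (Fin 4)), ℂ),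
          IsAppendTensorOf H (osAdjoint F) (translateMulti (EuclideanSpace.single 0 t) G) →
            ‖T.schwinger (1 + 1) (Fin.append (k ∘ Fin.rev) k') H -
                T.schwinger 1 (k ∘ Fin.rev) (osAdjoint F) * T.schwinger 1 k' G‖ ≤
              C * Real.exp (-Δ * t)

/-- The full gap contains its `(1,1)` sector. -/
theorem oneLegSector_of_hasMassGap {ι : Type} (T : OSData ι 4) (Δ : ℝ) (h : T.HasMassGap Δ) :
    OneLegSector T Δ :=
  fun k k' F G hF hG => h 1 1 k k' F G hF hG

/-- **Tame schemes** — exactly the hypothesis list of the landed R7 transfer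
`gapToContinuum_commensurableTransfer` (p127790): spacings eventually commensurable with one physical
length `t₀ > 0`; `0 ≤ β_k` eventually (odd-torus reflection positivity, defect D1); physical volume
beating `log a_k⁻¹` (Hankel-chain depth, defect D3b); reflection-symmetric, polynomially bounded
renormalisations (limits of reflected representatives; `log |c_s(k)| = O(log a_k⁻¹)`). -/
def IsTameScheme {G : Type} [Group G] [MeasurableSpace G] [MeasurableInv G]
    (sch : SpeciesScheme (YMSpecies G)) : Prop :=
  (∃ t₀ : ℝ, 0 < t₀ ∧ ∀ᶠ k in atTop, ∃ m : ℕ, sch.a k * m = t₀) ∧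
  (∀ᶠ k in atTop, 0 ≤ sch.β k) ∧
  Tendsto (fun k => sch.a k * sch.L k / Real.log (sch.a k)⁻¹) atTop atTop ∧
  sch.IsReflectionSymmetric ∧
  (∀ s, ∃ (q : ℕ) (K : ℝ), ∀ k,
    |sch.c s k| ≤ K * ((sch.a k)⁻¹) ^ q ∧ |sch.m s k| ≤ K * ((sch.a k)⁻¹) ^ q)

/-- **THE RUNG `OneLegTame`** (`rung_decl`): the crux `GapToContinuum` with its conclusion restricted
to the `(1,1)` sector and its scheme restricted to the tame class — SAME per-pair antecedent
`HasLatticeMassGap r sch Δ`, same `IsYangMillsFor`, same rate. -/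
def OneLegTame : Prop :=
  ∀ (G : Type) [Group G] [TopologicalSpace G] [IsTopologicalGroup G] [CompactSpace G]
    [MeasurableSpace G] [BorelSpace G] (r : LatticeRep G) (sch : SpeciesScheme (YMSpecies G))
    (T : OSData (YMSpecies G) 4) (Δ : ℝ), 0 < Δ → IsTameScheme sch →
      IsYangMillsFor r sch T → HasLatticeMassGap r sch Δ → OneLegSector T Δ

/-- **The next rung up (all sectors, tame schemes)** — named distance only: the crux restricted to
tame schemes.  Open; the multi-leg defect D2 lives exactly between `OneLegTame` and this. -/
def TameGapToContinuum : Prop :=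
  ∀ (G : Type) [Group G] [TopologicalSpace G] [IsTopologicalGroup G] [CompactSpace G]
    [MeasurableSpace G] [BorelSpace G] (r : LatticeRep G) (sch : SpeciesScheme (YMSpecies G))
    (T : OSData (YMSpecies G) 4) (Δ : ℝ), 0 < Δ → IsTameScheme sch →
      IsYangMillsFor r sch T → HasLatticeMassGap r sch Δ → T.HasMassGap Δ

/-- On-path certificate (top → rung): the crux gives the rung by restriction. -/
theorem oneLegTame_of_gapToContinuum
    (h : Summit.QuantumFields.YangMills.Theses.LangevinControlUV.GapToContinuum) : OneLegTame :=
  fun G _ _ _ _ _ _ r sch T Δ hΔ _ hYM hlat =>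
    oneLegSector_of_hasMassGap T Δ (h G r sch T Δ hΔ hYM hlat)

/-- Top → middle rung, by restriction. -/
theorem tameGapToContinuum_of_gapToContinuum
    (h : Summit.QuantumFields.YangMills.Theses.LangevinControlUV.GapToContinuum) : TameGapToContinuum :=
  fun G _ _ _ _ _ _ r sch T Δ hΔ _ hYM hlat => h G r sch T Δ hΔ hYM hlat

/-- Middle rung → rung, by restriction to the `(1,1)` sector. -/
theorem oneLegTame_of_tameGapToContinuum (h : TameGapToContinuum) : OneLegTame :=
  fun G _ _ _ _ _ _ r sch T Δ hΔ htame hYM hlat =>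
    oneLegSector_of_hasMassGap T Δ (h G r sch T Δ hΔ htame hYM hlat)

/-- **The ladder, typed** (named distance; the two gap hypotheses are NOT stubs and are not to be
attempted under this line): rung → (multi-leg step on tame schemes, D2) → (removal of tameness,
D1/D3b — the census's re-type door) → crux. -/
example (h₁ : OneLegTame) (gapMultiLeg : OneLegTame → TameGapToContinuum)
    (gapWild : TameGapToContinuum →
      Summit.QuantumFields.YangMills.Theses.LangevinControlUV.GapToContinuum) :
    Summit.QuantumFields.YangMills.Theses.LangevinControlUV.GapToContinuum :=
  gapWild (gapMultiLeg h₁)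

/-! ## The three stubs -/

/-- **Stub 1 — the cross far bound from TWO certified pairs (lattice, per-pair input).**  For an
arity-1 slab sum `D` and a species string `σ : Fin 1 → YMSpecies G`, with `X_k = D.rep sch (Θσ) k`,
`Y_k = D.rep sch σ k` the reflected-species and plain representatives on the scheme's own odd torus:
there are `C ≥ 0` and a physical length `κ₀` such that eventually in `k`, at `0 ≤ β_k`, for every
`c` with `‖c‖ ≤ 1` and every time shift `N` in the window `2 a_k N + κ₀ ≤ a_k L_k`,
`‖osCorr μ_k Θ₀ τ_N (X_k + c•Y_k) (X_k + c•Y_k)‖ ≤ (|c_{σ 0}(k)| + 1)² C e^{−Δ a_k N}`.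
Extends `OneLeg.norm_osCorr_smearedLatticeField_le` (one base observable) to the two bases
`(Θσ₀).F`, `σ₀.F`: pairs `(σ₀, Θσ₀)` (at separation `0`) and `(Θσ₀, σ₀)` of `HasLatticeMassGap`. -/
theorem stub_crossFarBound :
    ∀ {G : Type} [Group G] [TopologicalSpace G] [IsTopologicalGroup G] [CompactSpace G]
      [MeasurableSpace G] [BorelSpace G] (r : LatticeRep G) (sch : SpeciesScheme (YMSpecies G))
      {Δ : ℝ}, 0 ≤ Δ → HasLatticeMassGap r sch Δ → sch.IsReflectionSymmetric →
      ∀ (σ : Fin 1 → YMSpecies G) (D : SlabSum 1), ∃ (C κ₀ : ℝ), 0 ≤ C ∧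
        ∀ᶠ k in atTop, 0 ≤ sch.β k → ∀ (c : ℂ), ‖c‖ ≤ 1 → ∀ N : ℕ,
          sch.a k * (2 * N) + κ₀ ≤ sch.a k * sch.L k →
            ‖osCorr (wilsonMeasure r.ρ (sch.β k)) GaugeConfig.negReflect
                (torusTimeShift (sch.side k) N)
                (D.rep sch (fun i => (σ i).timeReflect) k + c • D.rep sch σ k)
                (D.rep sch (fun i => (σ i).timeReflect) k + c • D.rep sch σ k)‖ ≤
              (|sch.c (σ 0) k| + 1) ^ 2 * C * Real.exp (-(Δ * (sch.a k * N))) := by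
  sorry

/-- **Stub 2 — the Hankel transfer at arity 1 (lattice → continuum, tame schemes).**  R7's
`hasMassGap_of_slabClustering_commensurable` re-run at `nn = 1` with the far bound supplied only for
the four polarisation combinations of the two representatives (the conclusion of `stub_crossFarBound`):
the arity-1 DIAGONAL bound on `T` along the progression `j t₀`, free constant. -/
theorem stub_hankelTransferOne :
    ∀ (G : Type) [Group G] [TopologicalSpace G] [IsTopologicalGroup G] [CompactSpace G]
      [MeasurableSpace G] [BorelSpace G] (r : LatticeRep G) (sch : SpeciesScheme (YMSpecies G))
      (T : OSData (YMSpecies G) 4) (Δ t₀ : ℝ), 0 < Δ → 0 < t₀ →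
      (∀ᶠ k in atTop, ∃ m : ℕ, sch.a k * m = t₀) →
      (∀ᶠ k in atTop, 0 ≤ sch.β k) →
      Tendsto (fun k => sch.a k * sch.L k / Real.log (sch.a k)⁻¹) atTop atTop →
      sch.IsReflectionSymmetric →
      (∀ s, ∃ (q : ℕ) (K : ℝ), ∀ k,
        |sch.c s k| ≤ K * ((sch.a k)⁻¹) ^ q ∧ |sch.m s k| ≤ K * ((sch.a k)⁻¹) ^ q) →
      IsYangMillsFor r sch T →
      (∀ (σ : Fin 1 → YMSpecies G) (D : SlabSum 1), ∃ (C κ₀ : ℝ), 0 ≤ C ∧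
        ∀ᶠ k in atTop, 0 ≤ sch.β k → ∀ (c : ℂ), ‖c‖ ≤ 1 → ∀ N : ℕ,
          sch.a k * (2 * N) + κ₀ ≤ sch.a k * sch.L k →
            ‖osCorr (wilsonMeasure r.ρ (sch.β k)) GaugeConfig.negReflect
                (torusTimeShift (sch.side k) N)
                (D.rep sch (fun i => (σ i).timeReflect) k + c • D.rep sch σ k)
                (D.rep sch (fun i => (σ i).timeReflect) k + c • D.rep sch σ k)‖ ≤
              (|sch.c (σ 0) k| + 1) ^ 2 * C * Real.exp (-(Δ * (sch.a k * N)))) →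
      ∀ (σ : Fin 1 → YMSpecies G) (P : 𝓢((Fin 1 → EuclideanSpace ℝ (Fin 4)), ℂ)),
        P ∈ slabOrderedProducts 4 1 → ∃ C : ℝ, ∀ j : ℕ,
          ‖T.schwinger (1 + 1) (Fin.append (σ ∘ Fin.rev) σ)
                ((osAdjoint P).appendTensor
                  (translateMulti (EuclideanSpace.single 0 ((j : ℝ) * t₀)) P)) -
              T.schwinger 1 (σ ∘ Fin.rev) (osAdjoint P) * T.schwinger 1 σ P‖ ≤
            C * Real.exp (-Δ * ((j : ℝ) * t₀)) := by
  sorry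

/-- **Stub 3 — OS reconstruction at fixed arity `(1,1)`.**  Diagonal bounds with free constants
along a progression of times, for every species string of arity 1 and every slab-ordered real product
tensor of arity 1, give the `(1,1)` sector of the gap at the same rate (the Literature proof of
`OSData.hasMassGap_of_diagBound_progression` read at `n = m = 1`: `⟨v, e^{−tH} v⟩` self-improves to
`‖v‖² e^{−Δt}` along the progression, Cauchy–Schwarz on span × span, density of slab sums). -/
theorem stub_oneLegSector_of_diagBoundOne :
    ∀ {ι : Type} (T : OSData ι 4) (Δ : ℝ) {t₀ : ℝ}, 0 < t₀ →
      (∀ (σ : Fin 1 → ι) (P : 𝓢((Fin 1 → EuclideanSpace ℝ (Fin 4)), ℂ)),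
        P ∈ slabOrderedProducts 4 1 → ∃ C : ℝ, ∀ j : ℕ,
          ‖T.schwinger (1 + 1) (Fin.append (σ ∘ Fin.rev) σ)
                ((osAdjoint P).appendTensor
                  (translateMulti (EuclideanSpace.single 0 ((j : ℝ) * t₀)) P)) -
              T.schwinger 1 (σ ∘ Fin.rev) (osAdjoint P) * T.schwinger 1 σ P‖ ≤
            C * Real.exp (-Δ * ((j : ℝ) * t₀))) →
      OneLegSector T Δ := by
  sorry

/-! ## Composition -/

/-- **`OneLegTame_of` — the rung from the three stubs BY NAME** (registered form). -/
theorem OneLegTame_of : OneLegTame := by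
  intro G _ _ _ _ _ _ r sch T Δ hΔ htame hYM hlat
  obtain ⟨⟨t₀, ht₀, hcomm⟩, hβ, hvol, hsym, hpoly⟩ := htame
  exact stub_oneLegSector_of_diagBoundOne T Δ ht₀
    (stub_hankelTransferOne G r sch T Δ t₀ hΔ ht₀ hcomm hβ hvol hsym hpoly hYM
      (fun σ D => stub_crossFarBound r sch hΔ.le hlat hsym σ D))

/-- **The glue alone, `sorry`-free**: the three stub STATEMENTS as explicit hypotheses give the rung
(this `example` does not mention the stubs). -/
example
    (h₁ : ∀ {G : Type} [Group G] [TopologicalSpace G] [IsTopologicalGroup G] [CompactSpace G]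
      [MeasurableSpace G] [BorelSpace G] (r : LatticeRep G) (sch : SpeciesScheme (YMSpecies G))
      {Δ : ℝ}, 0 ≤ Δ → HasLatticeMassGap r sch Δ → sch.IsReflectionSymmetric →
      ∀ (σ : Fin 1 → YMSpecies G) (D : SlabSum 1), ∃ (C κ₀ : ℝ), 0 ≤ C ∧
        ∀ᶠ k in atTop, 0 ≤ sch.β k → ∀ (c : ℂ), ‖c‖ ≤ 1 → ∀ N : ℕ,
          sch.a k * (2 * N) + κ₀ ≤ sch.a k * sch.L k →
            ‖osCorr (wilsonMeasure r.ρ (sch.β k)) GaugeConfig.negReflect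
                (torusTimeShift (sch.side k) N)
                (D.rep sch (fun i => (σ i).timeReflect) k + c • D.rep sch σ k)
                (D.rep sch (fun i => (σ i).timeReflect) k + c • D.rep sch σ k)‖ ≤
              (|sch.c (σ 0) k| + 1) ^ 2 * C * Real.exp (-(Δ * (sch.a k * N))))
    (h₂ : ∀ (G : Type) [Group G] [TopologicalSpace G] [IsTopologicalGroup G] [CompactSpace G]
      [MeasurableSpace G] [BorelSpace G] (r : LatticeRep G) (sch : SpeciesScheme (YMSpecies G))
      (T : OSData (YMSpecies G) 4) (Δ t₀ : ℝ), 0 < Δ → 0 < t₀ →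
      (∀ᶠ k in atTop, ∃ m : ℕ, sch.a k * m = t₀) →
      (∀ᶠ k in atTop, 0 ≤ sch.β k) →
      Tendsto (fun k => sch.a k * sch.L k / Real.log (sch.a k)⁻¹) atTop atTop →
      sch.IsReflectionSymmetric →
      (∀ s, ∃ (q : ℕ) (K : ℝ), ∀ k,
        |sch.c s k| ≤ K * ((sch.a k)⁻¹) ^ q ∧ |sch.m s k| ≤ K * ((sch.a k)⁻¹) ^ q) →
      IsYangMillsFor r sch T →
      (∀ (σ : Fin 1 → YMSpecies G) (D : SlabSum 1), ∃ (C κ₀ : ℝ), 0 ≤ C ∧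
        ∀ᶠ k in atTop, 0 ≤ sch.β k → ∀ (c : ℂ), ‖c‖ ≤ 1 → ∀ N : ℕ,
          sch.a k * (2 * N) + κ₀ ≤ sch.a k * sch.L k →
            ‖osCorr (wilsonMeasure r.ρ (sch.β k)) GaugeConfig.negReflect
                (torusTimeShift (sch.side k) N)
                (D.rep sch (fun i => (σ i).timeReflect) k + c • D.rep sch σ k)
                (D.rep sch (fun i => (σ i).timeReflect) k + c • D.rep sch σ k)‖ ≤
              (|sch.c (σ 0) k| + 1) ^ 2 * C * Real.exp (-(Δ * (sch.a k * N)))) →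
      ∀ (σ : Fin 1 → YMSpecies G) (P : 𝓢((Fin 1 → EuclideanSpace ℝ (Fin 4)), ℂ)),
        P ∈ slabOrderedProducts 4 1 → ∃ C : ℝ, ∀ j : ℕ,
          ‖T.schwinger (1 + 1) (Fin.append (σ ∘ Fin.rev) σ)
                ((osAdjoint P).appendTensor
                  (translateMulti (EuclideanSpace.single 0 ((j : ℝ) * t₀)) P)) -
              T.schwinger 1 (σ ∘ Fin.rev) (osAdjoint P) * T.schwinger 1 σ P‖ ≤
            C * Real.exp (-Δ * ((j : ℝ) * t₀)))
    (h₃ : ∀ {ι : Type} (T : OSData ι 4) (Δ : ℝ) {t₀ : ℝ}, 0 < t₀ →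
      (∀ (σ : Fin 1 → ι) (P : 𝓢((Fin 1 → EuclideanSpace ℝ (Fin 4)), ℂ)),
        P ∈ slabOrderedProducts 4 1 → ∃ C : ℝ, ∀ j : ℕ,
          ‖T.schwinger (1 + 1) (Fin.append (σ ∘ Fin.rev) σ)
                ((osAdjoint P).appendTensor
                  (translateMulti (EuclideanSpace.single 0 ((j : ℝ) * t₀)) P)) -
              T.schwinger 1 (σ ∘ Fin.rev) (osAdjoint P) * T.schwinger 1 σ P‖ ≤
            C * Real.exp (-Δ * ((j : ℝ) * t₀))) →
      OneLegSector T Δ) :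
    OneLegTame := by
  intro G _ _ _ _ _ _ r sch T Δ hΔ htame hYM hlat
  obtain ⟨⟨t₀, ht₀, hcomm⟩, hβ, hvol, hsym, hpoly⟩ := htame
  exact h₃ T Δ ht₀ (h₂ G r sch T Δ t₀ hΔ ht₀ hcomm hβ hvol hsym hpoly hYM (fun σ D => h₁ r sch hΔ.le hlat hsym σ D))

/-- Signature match (kernel-checked): the registered composition IS the rung. -/
example : OneLegTame := OneLegTame_of

/-! ## Witness (F3 / BC5): the rung specialises to its proved floors — no `sorry` below

Floor A = R7 `SlabTransfer.gapToContinuum_commensurableTransfer` (p127790, pair-uniform slab clustering added;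
`HasLatticeMassGap` idle); floor B = `ZeroCoupling.gapToContinuum_on_zeroCouplingStratum` (p141172, stratum
`∀ᶠ k, β_k = 0`; tameness idle).  Witness regime: S (`YangMills`) is NOT known in either regime (both are
conditional transfers about a given limit).  Mirrored in `Lines/OneLegTame_special.lean`. -/

/-- **Floor B**: the rung on the zero-coupling stratum (p141172). -/
theorem oneLegTame_onZeroCouplingStratum :
    ∀ (G : Type) [Group G] [TopologicalSpace G] [IsTopologicalGroup G] [CompactSpace G]
      [MeasurableSpace G] [BorelSpace G] (r : LatticeRep G) (sch : SpeciesScheme (YMSpecies G))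
      (T : OSData (YMSpecies G) 4) (Δ : ℝ), (∀ᶠ k in atTop, sch.β k = 0) → 0 < Δ → IsTameScheme sch →
        IsYangMillsFor r sch T → HasLatticeMassGap r sch Δ → OneLegSector T Δ :=
  fun G _ _ _ _ _ _ r sch T Δ hβ hΔ _ hYM hlat =>
    oneLegSector_of_hasMassGap T Δ
      (Summit.QuantumFields.YangMills.Theorems.GapToContinuum.ZeroCoupling.gapToContinuum_on_zeroCouplingStratum
        G r sch T Δ hβ hΔ hYM hlat)

/-- **Floor A**: the rung under R7's extra pair-uniform slab clustering (p127790). -/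
theorem oneLegTame_onUniformSlabClustering :
    ∀ (G : Type) [Group G] [TopologicalSpace G] [IsTopologicalGroup G] [CompactSpace G]
      [MeasurableSpace G] [BorelSpace G] (r : LatticeRep G) (sch : SpeciesScheme (YMSpecies G))
      (T : OSData (YMSpecies G) 4) (Δ : ℝ), 0 < Δ → IsTameScheme sch →
        IsYangMillsFor r sch T → HasLatticeMassGap r sch Δ →
        (∃ (p : ℕ) (K : ℝ), 0 ≤ K ∧ ∀ᶠ k in atTop,
          ∀ (w N : ℕ) (X : GaugeConfig 4 (sch.side k) G → ℂ) (B : ℝ), Measurable X →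
            (∀ U, ‖X U‖ ≤ B) →
            DependsOn X {e : Edge 4 (sch.side k) | 1 ≤ (e.1 0).val ∧ (e.1 0).val ≤ w} →
            N + 2 * w ≤ sch.L k →
              ‖osCorr (wilsonMeasure r.ρ (sch.β k)) GaugeConfig.negReflect
                  (torusTimeShift (sch.side k) N) X X‖ ≤
                K * ((sch.a k)⁻¹ * ((w : ℝ) + 1) * ((sch.L k : ℝ) + 1)) ^ p * B ^ 2 *
                  Real.exp (-Δ * sch.a k * N)) →
        OneLegSector T Δ := by
  intro G _ _ _ _ _ _ r sch T Δ hΔ htame hYM _ hclust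
  obtain ⟨hcomm, hβ, hvol, hsym, hpoly⟩ := htame
  exact oneLegSector_of_hasMassGap T Δ
    (Summit.QuantumFields.YangMills.Theorems.GapToContinuum.SlabTransfer.gapToContinuum_commensurableTransfer
      G r sch T Δ hΔ hcomm hβ hvol hsym hpoly hYM hclust)

/-- The rung's statement with floor B's clause, as a closed `example` (F3 shape). -/
example : ∀ (G : Type) [Group G] [TopologicalSpace G] [IsTopologicalGroup G] [CompactSpace G]
      [MeasurableSpace G] [BorelSpace G] (r : LatticeRep G) (sch : SpeciesScheme (YMSpecies G))
      (T : OSData (YMSpecies G) 4) (Δ : ℝ), (∀ᶠ k in atTop, sch.β k = 0) → 0 < Δ → IsTameScheme sch →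
        IsYangMillsFor r sch T → HasLatticeMassGap r sch Δ → OneLegSector T Δ :=
  oneLegTame_onZeroCouplingStratum


end Summit.QuantumFields.YangMills.Cruxes.GapToContinuum.OneLegTameLine

end
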